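import Literature.AlgebraicGeometry.AbelianSchemes.AbelianSchemeBaseQuotientDescent
import Literature.AlgebraicGeometry.AbelianSchemes.AbelianSchemeConstSubgroupStableCover
import Literature.AlgebraicGeometry.RelativeSpec.GeometricQuotientRecognition
import Literature.AlgebraicGeometry.RelativeSpec.FiniteGroupQuotientGluedProperties
import Literature.AlgebraicGeometry.RelativeSpec.SymmetricPowerGlued
import HarnessLib

/-!
# An abelian scheme descends along a free finite quotient of an AFFINE base — the total-space quotient from
# «every finite set of points lies in an affine open» ([MumfordAV1970] §7 Thm. p. 66; [MFK94] Ch. 7 §3 Lemma 7.11)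

Topic `AlgebraicGeometry/AbelianSchemes`; namespace `Literature.AlgebraicGeometry.AbelianSchemes.AbelianSchemeOver`.
THEOREMS ONLY (no definition, no named fact, no instance, no notation, no `sorry`; net Literature debt 0).

★ `AbelianSchemeBaseQuotientDescent.exists_grpObj_isBaseChangeVia_of_free_base_quotient` ([MFK94] Lemma 7.11 in the tree's
currency, ANY base) descends an abelian scheme `A → S` along a free affine geometric quotient `p : S → Q = S/G` of the base
PROVIDED the quotient `π : A → B₀` of the TOTAL SPACE by the covering `G`-action is given (an affine geometric quotient with
separated `B₀ → Q`).  ★ `AbelianSchemeBaseQuotientDescentOfQuasiProjective` supplies `π` when everything lives over a FIELD `k`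
and the total space is quasi-projective over `k` (packaging: ★ `Motives.finiteQuotient`).  THIS FILE supplies `π` over an
arbitrary AFFINE base `Q` (any ring, no field anywhere) from Mumford's PRINTED hypothesis «every finite set of points of `A`
lies in an affine open» ([MumfordAV1970] §7 Thm. p. 66 hypothesis and Remark p. 69), using the tree's base-relative quotient
machinery directly: the `G`-stable opens affine over `Q` cover `A` (★ `ActionOver.forall_exists_mem_stableAffineOpens_of_orbit`,
`Q` affine, `A` separated), Mumford's glued quotient ★ `ActionOver.glued` / `gluedMk` is an affine, finite, `G`-invariant
GEOMETRIC QUOTIENT (★ `isGeometricQuotient_gluedMk`, `isFinite_gluedMk`), the invariant `A → S → Q` descends to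
`b : A/G → Q` (★ `gluedDesc`), separated (★ `isSeparated_gluedDesc`); then ★ Lemma 7.11.

* §1 `exists_totalSpace_quotient_of_forall_finset` — THE TOTAL-SPACE QUOTIENT over an affine base: for `p : S → Q` separated
  and locally of finite type with `Q` AFFINE, `ρ` an action of the finite group `G` on `S` over `p`, an abelian scheme `A → S`
  with a `G`-action `autA` on its total space covering `ρ` compatibly with the group law (`hA : A.IsBaseChangeVia A (ρ g)
  (autA g)`), and every finite set of points of `A` in an affine open: a separated scheme `B₀` with `b : B₀ → Q` and an
  AFFINE, FINITE GEOMETRIC QUOTIENT `π : A → B₀` of the action (viewed over `π`) with `A.hom ≫ p = π ≫ b`.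
* §2 **`exists_abelianScheme_desc_of_forall_finset`** — if moreover `p` is a FREE affine geometric quotient (`hq`, `hfree`),
  then `A` DESCENDS: an abelian scheme `B` over `Q` with `π : A → B` exhibiting `A ≅ S ×_Q B` as group schemes (★
  `IsBaseChangeVia`), the `G`-action on `A` over `π` (`ρA`, `(ρA g) = autA g`) an affine finite geometric quotient.

Cell `hodgecm-mathlib` (D-0151), FLOOR 0 programme P1, sub-line `Cruxes/HDel/Lines/F3DualAbelianScheme` (author of record
B-plan1 (g19)), stub (M) `stub_F3M` = Mumford's construction `Â := A ⁄ K(L)` over a Noetherian affine `ℚ`-base `Spec R`, inner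
cut v0.1 (e9a22f2a) step (M-d)(d2) «the OBJECT `B̂ := Â′ ⁄ G` — free-finite-group quotient of the étale-local dual `Â′ → S′`
along the level-basis cover `S′ → Spec R` in the carrier of record `(ρ : ActionOver p G) (hq) [IsAffineHom p] (hfree)`»: §2
with `Q := Spec R`, `S := S′`, `A := Â′` IS that step, modulo the one input «finite subsets of `Â′` lie in affine opens» (⇐
`Â′ → Spec R` projective, ★ graded prime avoidance `Motives.exists_form_finset_isAffineOpen_preimage`, any graded ring) — the
same `∀ s : Finset, ∃ U, IsAffineOpen U ∧ …` currency as the (M-b) quotient ★ `translationActionOver_hcov_of_forall_finset`.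
The FIELDS of the descended dual pair are ★ `DualPairBaseQuotientDescentOfNoetherian` ((M-d)(d1), `Â′` not assumed reduced).
Count-neutral; HC_CM is proved only modulo the 7 printed citations until rung 0 closes; this file discharges none of them.

Mathlib searched (pin): `terminal.comp_from`, `IsSeparated` of compositions, `IsAffine → IsSeparated` (instances, used);
Mathlib has no quotients of schemes by finite groups and no abelian schemes.

## References
* D. Mumford, *Abelian Varieties* (1970), §7 Thm. p. 66 (quotients by finite groups under «every orbit lies in an affine
  open») and Remark p. 69; §7 Thm. 4 (p. 72). [MumfordAV1970]
* D. Mumford, J. Fogarty, F. Kirwan, *Geometric Invariant Theory*, 3rd ed. (1994), Ch. 7 §1 Prop. 7.1 (p. 127); Ch. 7 §3,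
  remark after Thm. 7.9 and Lemma 7.11 (pp. 139–140). [MumfordFogartyKirwan1994]
* A. Grothendieck, *SGA 1*, Exp. V Prop. 1.1, Cor. 1.5, Prop. 1.8; Exp. VIII Cor. 7.8. [SGA1]
-/

noncomputable section

universe u

open CategoryTheory CategoryTheory.Limits AlgebraicGeometry

namespace Literature.AlgebraicGeometry.AbelianSchemes.AbelianSchemeOver

open Literature.AlgebraicGeometry.RelativeSpec Literature.AlgebraicGeometry.RelativeSpec.ActionOver

set_option backward.isDefEq.respectTransparency false

variable {S Q : Scheme.{u}} [IsAffine Q] (p : S ⟶ Q) [IsSeparated p] [LocallyOfFiniteType p] {G : Type u} [Group G]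
  [Fintype G] (ρ : ActionOver p G) (A : AbelianSchemeOver S) (autA : G →* Aut A.X.left)
  (hA : ∀ g : G, A.IsBaseChangeVia A (ρ.aut g).hom (autA g).hom)
  (hfin : ∀ s : Finset A.left, ∃ U : A.left.Opens, IsAffineOpen U ∧ ∀ x ∈ s, x ∈ U)

/-! ### §1 The total-space quotient over an affine base -/

include hA hfin in
/-- **THE TOTAL-SPACE QUOTIENT OVER AN AFFINE BASE** ([MumfordAV1970] §7 Thm. p. 66).  For `p : S → Q` separated and locally
of finite type with `Q` AFFINE, `ρ` an action of the finite group `G` on `S` over `p`, an abelian scheme `A → S` every finite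
set of points of whose total space lies in an affine open (Mumford's hypothesis, [MumfordAV1970] §7 Remark p. 69), and a
`G`-action `autA` on the total space covering `ρ` compatibly with the group law (`hA : A.IsBaseChangeVia A (ρ g) (autA g)`),
Mumford's quotient of the total space by `G` exists: a separated scheme `B₀` with `b : B₀ → Q`, and an AFFINE, indeed FINITE,
GEOMETRIC QUOTIENT `π : A → B₀` of the action (viewed over `π`) with `A.hom ≫ p = π ≫ b`.  (Every orbit is finite, hence in an
affine open, hence in a `G`-stable open affine over `Q` — ★ `forall_exists_mem_stableAffineOpens_of_orbit`; `π :=` ★ `gluedMk`,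
a geometric quotient by ★ `isGeometricQuotient_gluedMk`, finite by ★ `isFinite_gluedMk`; `b :=` ★ `gluedDesc` of the
`G`-invariant `A → S → Q`, separated by ★ `isSeparated_gluedDesc`.)  ★ `exists_totalSpace_quotient_of_isQuasiProjectiveOver`
without a ground field. [cite: MumfordAV1970, §7 Thm. p. 66 and Remark p. 69]
[cite: MumfordFogartyKirwan1994, Ch. 7 §3, remark after Thm. 7.9 and Lemma 7.11 (pp. 139–140)] [cite: SGA1, Exp. V Prop. 1.1 and Prop. 1.8] -/
theorem exists_totalSpace_quotient_of_forall_finset :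
    ∃ (B₀ : Scheme.{u}) (b : B₀ ⟶ Q) (π : A.X.left ⟶ B₀) (ρA : ActionOver π G),
      (∀ g : G, (ρA.aut g).hom = (autA g).hom) ∧ ρA.IsGeometricQuotient π ∧ IsAffineHom π ∧ IsFinite π ∧
        B₀.IsSeparated ∧ A.X.hom ≫ p = π ≫ b := by
  have hsq : ∀ g : G, (autA g).hom ≫ A.X.hom = A.X.hom ≫ (ρ.aut g).hom := fun g => (hA g).fst
  -- the action on the total space, over the `G`-invariant structure map `A → S → Q`
  let ρ₀ : ActionOver (A.X.hom ≫ p) G := ⟨autA, fun g => by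
    rw [← Category.assoc, hsq g, Category.assoc, ρ.aut_comp g]⟩
  haveI : IsProper A.X.hom := A.isProper
  haveI : IsSeparated (A.X.hom ≫ p) := inferInstance
  haveI : LocallyOfFiniteType (A.X.hom ≫ p) := inferInstance
  haveI : A.left.IsSeparated := A.isSeparated_left_of_isAffine p
  -- every orbit is finite, hence in an affine open, hence in a `G`-stable open affine over `Q`: Mumford's quotient exists
  have hcov : ∀ x : A.X.left, ∃ O : ρ₀.StableAffineOpens, x ∈ O.1 := by
    classical
    refine ρ₀.forall_exists_mem_stableAffineOpens_of_orbit fun x => ?_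
    obtain ⟨U, hU, hx⟩ := hfin (Finset.univ.image fun g : G => (ρ₀.aut g).hom x)
    exact ⟨U, hU, fun g => hx _ (Finset.mem_image_of_mem _ (Finset.mem_univ g))⟩
  -- the quotient map is invariant, and a geometric quotient for the action over it
  have hinv : ∀ g : G, (ρ₀.aut g).hom ≫ ρ₀.gluedMk hcov = ρ₀.gluedMk hcov := fun g => ρ₀.aut_hom_gluedMk hcov g
  let ρA : ActionOver (ρ₀.gluedMk hcov) G := ⟨ρ₀.aut, hinv⟩
  have hπ : ρA.IsGeometricQuotient (ρ₀.gluedMk hcov) :=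
    (ρ₀.isGeometricQuotient_overMap_iff _ hinv _).mpr (ρ₀.isGeometricQuotient_gluedMk hcov)
  -- `A → S → Q` is `G`-invariant, hence descends to `b : A/G → Q`, separated
  haveI hbsep : IsSeparated (ρ₀.gluedDesc (A.X.hom ≫ p) ρ₀.aut_comp) :=
    ρ₀.isSeparated_gluedDesc hcov (A.X.hom ≫ p) ρ₀.aut_comp
  have hB₀ : ρ₀.glued.IsSeparated :=
    ⟨by rw [← terminal.comp_from (ρ₀.gluedDesc (A.X.hom ≫ p) ρ₀.aut_comp)]; infer_instance⟩
  exact ⟨ρ₀.glued, ρ₀.gluedDesc (A.X.hom ≫ p) ρ₀.aut_comp, ρ₀.gluedMk hcov, ρA, fun _ => rfl, hπ, inferInstance,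
    ρ₀.isFinite_gluedMk hcov, hB₀, (ρ₀.gluedMk_gluedDesc hcov (A.X.hom ≫ p) ρ₀.aut_comp).symm⟩

/-! ### §2 Descent of the abelian scheme along a free base quotient, affine base -/

variable {p ρ}
variable (hq : ρ.IsGeometricQuotient p) [IsAffineHom p]
  (hfree : ∀ (V : Q.Opens), IsAffineOpen V → ∀ g : G, g ≠ 1 →
    Ideal.span (Set.range fun s : Γ(S, p ⁻¹ᵁ V) ↦ ρ.act g V s - s) = ⊤)

include hA hfin hq hfree in
/-- **AN ABELIAN SCHEME, EVERY FINITE SET OF POINTS OF WHOSE TOTAL SPACE LIES IN AN AFFINE OPEN, DESCENDS ALONG A FREE FINITE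
QUOTIENT OF AN AFFINE BASE** ([MumfordFogartyKirwan1994] Ch. 7 §3, remark after Thm. 7.9 and Lemma 7.11).  `Q` AFFINE (any
ring — no ground field); `p : S → Q` a FREE affine geometric quotient by the finite group `G` (`hq`, `hfree`; the carrier of
★ `DualPairBaseQuotientDescent`), separated and locally of finite type; `A → S` an abelian scheme with a `G`-action `autA` on its
total space covering `ρ` compatibly with the group law, every finite subset of the total space in an affine open.  Then there is
an abelian scheme `B` over `Q` and an affine, finite geometric quotient `π : A → B` of the `G`-action (`ρA`, `(ρA g) = autA g`)
which exhibits `A` as the base change `S ×_Q B` AS A GROUP SCHEME (★ `IsBaseChangeVia`) — §1 fed into ★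
`exists_grpObj_isBaseChangeVia_of_free_base_quotient`.  With `Q = Spec R`, `S = S′` the level-basis cover and `A = Â′` the
étale-local dual, this is step (M-d)(d2) of Mumford's construction of the dual abelian scheme over a Noetherian `ℚ`-algebra.
[cite: MumfordFogartyKirwan1994, Ch. 7 §3, remark after Thm. 7.9 and Lemma 7.11 (pp. 139–140)]
[cite: MumfordFogartyKirwan1994, Ch. 7 §1 Prop. 7.1 (p. 127)] [cite: MumfordAV1970, §7 Thm. p. 66 and Remark p. 69]
[cite: SGA1, Exp. VIII Cor. 7.8] -/
theorem exists_abelianScheme_desc_of_forall_finset :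
    ∃ (B : AbelianSchemeOver Q) (π : A.X.left ⟶ B.X.left) (ρA : ActionOver π G),
      (∀ g : G, (ρA.aut g).hom = (autA g).hom) ∧ ρA.IsGeometricQuotient π ∧ IsAffineHom π ∧ IsFinite π ∧
        B.X.left.IsSeparated ∧ A.IsBaseChangeVia B p π := by
  obtain ⟨B₀, b, π, ρA, hρA, hπ, haff, hfin', hsep, hb⟩ :=
    exists_totalSpace_quotient_of_forall_finset p ρ A autA hA hfin
  haveI := haff
  haveI := hsep
  have hA' : ∀ g : G, A.IsBaseChangeVia A (ρ.aut g).hom (ρA.aut g).hom := fun g => by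
    rw [hρA g]
    exact hA g
  obtain ⟨grp, hpr, hsm, hgc, hbc⟩ := exists_grpObj_isBaseChangeVia_of_free_base_quotient hq hfree A hπ hA' b hb
  exact ⟨@AbelianSchemeOver.mk Q (Over.mk b) grp hpr hsm hgc, π, ρA, hρA, hπ, haff, hfin', hsep, hbc⟩

end Literature.AlgebraicGeometry.AbelianSchemes.AbelianSchemeOver

end
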